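import Mathlib
import HarnessLib
import Summits.CriticalPhenomena.CardyFormulaZ2.Theses.CardyStressTensorWard

/-!
# Birth skeleton of the split child `DeformationLipschitz` (stmt-CriticalPhenomena-18768) of `HadamardRegularity`

`DeformationLipschitz ⇐ stub_lipVanishingAtMarks ∧ stub_lipMarkTranslation` — the a-priori Lipschitz bound cut at the
MARKED POINTS (see the strategist note attached to the item: a union bound over `ε`-windows loses `log(1/ε)` at a mark
unless the displacement vanishes there; the first variation converges at a mark only as a principal value, by the
cancellation "a translated corner has the same modulus"):

* `stub_lipVanishingAtMarks` — two-field, mesh-uniform Lipschitz bound for pairs of fields whose difference VANISHES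
  AT THE FOUR MARKS (window union bound: half-plane 3-arm exponent 2 on the arcs, 2-arm exponent 1 at the marks,
  up to constants — no log because the window at distance `d` from a mark has width `O(εd)`);
* `stub_lipMarkTranslation` — two-field Lipschitz bound for pairs whose difference is LOCALLY CONSTANT near each
  mark (radius `ρ'`, constant depending on `ρ'`): the mark-translation part, where translation covariance of
  `bondPercolation (zdGraph 2) half` and of the discretisation must replace the union bound.

Composition (sorry-free): smooth cut-offs `χᵢ` (`ContDiffBump` at `R.pt i`, radii `s/4 < s/3`, `s` = minimal
separation of the marks) give `W = Σᵢ χᵢ • V(pt i)`; `V − W` vanishes at the marks, `W` is constant near them;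
triangle inequality through a `W`-family (contraction principle, `exists_family`) and the constant family `Φ 0`;
pointwise `C¹` bookkeeping turns both bounds into `C · |ε| · sSup_(closedBall 0 r) (‖V‖ + ‖DV‖)` with
`r = max r₁ r₂`, `C = C₁ (5 + D) + C₂ (4 + D)`, `D = Σᵢ sup ‖Dχᵢ‖`. Strategist `cstrat-stmt-CriticalPhenomena-4567-r1`
(written under the parent's `Cruxes/HadamardRegularity/Lines/`).
-/

noncomputable section

namespace Summit.CriticalPhenomena.CardyFormulaZ2.Cruxes.HadamardRegularity.BirthDeformationLipschitz

open scoped Topology NNReal Manifold ContDiff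
open Filter Set Function Metric
open Literature.Probability.Percolation Literature.Probability.RandomPlanarGeometry

/-- Stub 1 — two-field Lipschitz bound for differences vanishing at the marks (window union bound regime). -/
theorem stub_lipVanishingAtMarks :
    (open Literature.Probability.Percolation Literature.Probability.LatticeModels Literature.Probability.RandomPlanarGeometry in ∀ R : ConformalRectangle, ∃ C₁ r₁ : ℝ, closure R.carrier ⊆ Metric.ball (0:ℂ) r₁ ∧ ∀ (V W : ℂ → ℂ), ContDiff ℝ 2 V → (∃ B : ℝ, ∀ z : ℂ, ‖V z‖ ≤ B * (1 + ‖z‖) ∧ ‖fderiv ℝ V z‖ ≤ B) → ContDiff ℝ 2 W → (∃ B : ℝ, ∀ z : ℂ, ‖W z‖ ≤ B * (1 + ‖z‖) ∧ ‖fderiv ℝ W z‖ ≤ B) → (∀ i : Fin 4, V (R.pt i) = W (R.pt i)) → ∀ m : ℝ, (∀ z ∈ Metric.closedBall (0:ℂ) r₁, ‖V z - W z‖ + ‖fderiv ℝ V z - fderiv ℝ W z‖ ≤ m) → ∀ Φ : ℝ → ℂ ≃ₜ ℂ, (∀ᶠ ε in 𝓝 (0:ℝ), ∀ z ∈ closure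 R.carrier, Φ ε z = z + (ε : ℂ) * V z) → ∀ Ψ : ℝ → ℂ ≃ₜ ℂ, (∀ᶠ ε in 𝓝 (0:ℝ), ∀ z ∈ closure R.carrier, Ψ ε z = z + (ε : ℂ) * W z) → ∀ᶠ ε in 𝓝 (0:ℝ), ∀ᶠ δ in 𝓝[>] (0:ℝ), |bondDomainCrossingProb (R.map (Φ ε)) δ - bondDomainCrossingProb (R.map (Ψ ε)) δ| ≤ C₁ * |ε| * m) := by
  sorry

/-- Stub 2 — two-field Lipschitz bound for differences locally constant near the marks (mark-translation regime). -/
theorem stub_lipMarkTranslation :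
    (open Literature.Probability.Percolation Literature.Probability.LatticeModels Literature.Probability.RandomPlanarGeometry in ∀ R : ConformalRectangle, ∀ ρ' : ℝ, 0 < ρ' → ∃ C₂ r₂ : ℝ, closure R.carrier ⊆ Metric.ball (0:ℂ) r₂ ∧ ∀ (V W : ℂ → ℂ), ContDiff ℝ 2 V → (∃ B : ℝ, ∀ z : ℂ, ‖V z‖ ≤ B * (1 + ‖z‖) ∧ ‖fderiv ℝ V z‖ ≤ B) → ContDiff ℝ 2 W → (∃ B : ℝ, ∀ z : ℂ, ‖W z‖ ≤ B * (1 + ‖z‖) ∧ ‖fderiv ℝ W z‖ ≤ B) → (∀ i : Fin 4, ∃ c : ℂ, ∀ z ∈ Metric.ball (R.pt i) ρ', V z - W z = c) → ∀ m : ℝ, (∀ z ∈ Metric.closedBall (0:ℂ) r₂, ‖V z - W z‖ + ‖fderiv ℝ V z - fderiv ℝ W z‖ ≤ m) → ∀ Φ : ℝ → ℂ ≃ₜ ℂ, (∀ᶠ ε in 𝓝 (0:ℝ), ∀ z ∈ closure R.carrier, Φ ε z = z + (ε : ℂ) * V z) → ∀ Ψ : ℝ → ℂ ≃ₜ ℂ,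 (∀ᶠ ε in 𝓝 (0:ℝ), ∀ z ∈ closure R.carrier, Ψ ε z = z + (ε : ℂ) * W z) → ∀ᶠ ε in 𝓝 (0:ℝ), ∀ᶠ δ in 𝓝[>] (0:ℝ), |bondDomainCrossingProb (R.map (Φ ε)) δ - bondDomainCrossingProb (R.map (Ψ ε)) δ| ≤ C₂ * |ε| * m) := by
  sorry

/-! ### §0 Vocabulary (data-valued helpers) -/

/-- The admissible deformation fields of `HadamardRegularity` — `C²` fields of linear growth with bounded
derivative — as an `ℝ`-submodule of `ℂ → ℂ`. [folklore] -/
def niceSub : Submodule ℝ (ℂ → ℂ) where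
  carrier := {V | ContDiff ℝ 2 V ∧ ∃ B : ℝ, ∀ z : ℂ, ‖V z‖ ≤ B * (1 + ‖z‖) ∧ ‖fderiv ℝ V z‖ ≤ B}
  add_mem' := by
    rintro V W ⟨hV, B, hB⟩ ⟨hW, B', hB'⟩
    have hdV : Differentiable ℝ V := hV.differentiable (by norm_num)
    have hdW : Differentiable ℝ W := hW.differentiable (by norm_num)
    refine ⟨hV.add hW, B + B', fun z => ⟨?_, ?_⟩⟩
    · calc ‖(V + W) z‖ = ‖V z + W z‖ := rfl
        _ ≤ ‖V z‖ + ‖W z‖ := norm_add_le _ _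
        _ ≤ B * (1 + ‖z‖) + B' * (1 + ‖z‖) := add_le_add (hB z).1 (hB' z).1
        _ = (B + B') * (1 + ‖z‖) := by ring
    · have h : fderiv ℝ (V + W) z = fderiv ℝ V z + fderiv ℝ W z :=
        fderiv_add (hdV z) (hdW z)
      rw [h]
      exact (norm_add_le _ _).trans (add_le_add (hB z).2 (hB' z).2)
  zero_mem' := by
    refine ⟨contDiff_const, 0, fun z => ⟨by simp, ?_⟩⟩
    simp
  smul_mem' := by
    rintro c V ⟨hV, B, hB⟩
    have hdV : Differentiable ℝ V := hV.differentiable (by norm_num)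
    refine ⟨hV.const_smul c, ‖c‖ * B, fun z => ⟨?_, ?_⟩⟩
    · calc ‖(c • V) z‖ = ‖c‖ * ‖V z‖ := by simp
        _ ≤ ‖c‖ * (B * (1 + ‖z‖)) := mul_le_mul_of_nonneg_left (hB z).1 (norm_nonneg _)
        _ = ‖c‖ * B * (1 + ‖z‖) := by ring
    · have h : fderiv ℝ (c • V) z = c • fderiv ℝ V z := fderiv_const_smul (hdV z) c
      rw [h, norm_smul]
      exact mul_le_mul_of_nonneg_left (hB z).2 (norm_nonneg _)

/-- Families of plane homeomorphisms whose germ at `ε = 0` deforms `R̄` by `id + εV` (only the values on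
`closure R.carrier` matter for `R.map`). [folklore] -/
def famSet (R : ConformalRectangle) (V : ℂ → ℂ) : Set (ℝ → ℂ ≃ₜ ℂ) :=
  {Φ | ∀ᶠ ε in 𝓝 (0:ℝ), ∀ z ∈ closure R.carrier, Φ ε z = z + (ε : ℂ) * V z}

/-- Asymptotic (mesh-uniform) first variations of the crossing probability along a family `Φ`. [folklore] -/
def aderivSet (R : ConformalRectangle) (Φ : ℝ → ℂ ≃ₜ ℂ) : Set ℝ :=
  {L | ∀ η : ℝ, 0 < η → ∀ᶠ ε in 𝓝 (0:ℝ), ∀ᶠ δ in 𝓝[>] (0:ℝ),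
    |bondDomainCrossingProb (R.map (Φ ε)) δ - bondDomainCrossingProb (R.map (Φ 0)) δ - ε * L| ≤ η * |ε|}

/-- Asymptotic first variations of the crossing probability of `R` along the field `V`: along EVERY family
with germ `id + εV` on `R̄`. [folklore] -/
def hasVarSet (R : ConformalRectangle) (V : ℂ → ℂ) : Set ℝ :=
  {L | ∀ Φ ∈ famSet R V, L ∈ aderivSet R Φ}

/-! ### §1 The image marked domain depends only on the homeomorphism on the closure -/

theorem jordanDomain_eq {D E : JordanDomain} (hc : D.carrier = E.carrier) (hb : D.boundary = E.boundary) :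
    D = E := by
  obtain ⟨c, b, _, _, _, _, _, _, _⟩ := D
  obtain ⟨c', b', _, _, _, _, _, _, _⟩ := E
  simp only at hc hb
  subst hc
  subst hb
  rfl

theorem markedDomain_eq {n : ℕ} {D E : MarkedDomain n} (h : D.toJordanDomain = E.toJordanDomain)
    (hm : D.mark = E.mark) : D = E := by
  obtain ⟨J, m, _, _⟩ := D
  obtain ⟨J', m', _, _⟩ := E
  simp only at h hm
  subst h
  subst hm
  rfl

/-- `R.map φ` depends only on `φ` restricted to `closure R.carrier` (carrier image and boundary loop). [folklore] -/
theorem map_congr (R : ConformalRectangle) {φ ψ : ℂ ≃ₜ ℂ} (h : ∀ z ∈ closure R.carrier, φ z = ψ z) :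
    R.map φ = R.map ψ := by
  refine markedDomain_eq (jordanDomain_eq ?_ ?_) rfl
  · show φ '' R.carrier = ψ '' R.carrier
    exact image_congr fun z hz => h z (subset_closure hz)
  · show (φ : ℂ → ℂ) ∘ R.boundary = ψ ∘ R.boundary
    funext t
    exact h _ (by rw [R.toJordanDomain.closure_eq]; exact Or.inr (mem_range_self t))

/-! ### §2 The homeomorphisms `z ↦ z + ε V z` (contraction principle) -/

theorem lipschitz_of_mem {V : ℂ → ℂ} (hV : V ∈ niceSub) : ∃ K : ℝ≥0, LipschitzWith K V := by
  obtain ⟨hV, B, hB⟩ := hV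
  refine ⟨B.toNNReal, lipschitzWith_of_nnnorm_fderiv_le (hV.differentiable (by norm_num)) fun z => ?_⟩
  rw [← NNReal.coe_le_coe, coe_nnnorm]
  exact (hB z).2.trans (Real.le_coe_toNNReal B)

theorem perturb_inverse {V : ℂ → ℂ} {K : ℝ≥0} (hV : LipschitzWith K V) {ε : ℝ} (hε : |ε| * K ≤ 1 / 2) :
    ∃ g : ℂ → ℂ, LipschitzWith 2 g ∧ Function.LeftInverse g (fun z => z + (ε:ℂ) * V z) ∧
      Function.RightInverse g (fun z => z + (ε:ℂ) * V z) := by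
  -- `T y x = y - ε V x` is a contraction for every `y`
  have hT : ∀ y : ℂ, ContractingWith (‖ε‖₊ * K) (fun x => y - (ε:ℂ) * V x) := by
    intro y
    refine ⟨?_, LipschitzWith.of_dist_le_mul fun a b => ?_⟩
    · rw [← NNReal.coe_lt_coe, NNReal.coe_mul, coe_nnnorm, Real.norm_eq_abs]
      push_cast
      linarith
    · have h1 := hV.dist_le_mul a b
      rw [dist_eq_norm, dist_eq_norm] at *
      calc ‖y - (ε:ℂ) * V a - (y - (ε:ℂ) * V b)‖ = ‖(ε:ℂ) * (V b - V a)‖ := by ring_nf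
        _ = |ε| * ‖V a - V b‖ := by rw [norm_mul, Complex.norm_real, Real.norm_eq_abs, norm_sub_rev]
        _ ≤ |ε| * (K * ‖a - b‖) := mul_le_mul_of_nonneg_left h1 (abs_nonneg _)
        _ = (‖ε‖₊ * K : ℝ≥0) * ‖a - b‖ := by push_cast; rw [Real.norm_eq_abs]; ring
  set g : ℂ → ℂ := fun y => ContractingWith.fixedPoint _ (hT y) with hg
  have hfix : ∀ y, y - (ε:ℂ) * V (g y) = g y := fun y => ContractingWith.fixedPoint_isFixedPt (hT y)
  have hεK : |ε| * K ≤ 1 / 2 := hε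
  refine ⟨g, LipschitzWith.of_dist_le_mul fun y y' => ?_, fun x => ?_, fun y => ?_⟩
  · have h1 := hV.dist_le_mul (g y) (g y')
    rw [dist_eq_norm, dist_eq_norm] at *
    have h2 : g y - g y' = (y - y') - (ε:ℂ) * (V (g y) - V (g y')) := by
      linear_combination (-1 : ℂ) * hfix y + hfix y'
    have h3 : ‖g y - g y'‖ ≤ ‖y - y'‖ + |ε| * (K * ‖g y - g y'‖) := by
      calc ‖g y - g y'‖ = ‖(y - y') - (ε:ℂ) * (V (g y) - V (g y'))‖ := by rw [h2]
        _ ≤ ‖y - y'‖ + ‖(ε:ℂ) * (V (g y) - V (g y'))‖ := norm_sub_le _ _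
        _ ≤ ‖y - y'‖ + |ε| * (K * ‖g y - g y'‖) := by
          refine add_le_add le_rfl ?_
          rw [norm_mul, Complex.norm_real, Real.norm_eq_abs]
          exact mul_le_mul_of_nonneg_left h1 (abs_nonneg _)
    have h4 : |ε| * (K * ‖g y - g y'‖) ≤ (1 / 2) * ‖g y - g y'‖ := by
      rw [← mul_assoc]
      exact mul_le_mul_of_nonneg_right hεK (norm_nonneg _)
    push_cast
    linarith
  · -- `x` is a fixed point of `T (x + ε V x)`
    symm
    refine ContractingWith.fixedPoint_unique (hT (x + (ε:ℂ) * V x)) ?_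
    show x + (ε:ℂ) * V x - (ε:ℂ) * V x = x
    ring
  · show g y + (ε:ℂ) * V (g y) = y
    have := hfix y
    linear_combination (-1 : ℂ) * this

/-- The homeomorphism `z ↦ z + ε V z` of the plane, for `V` `K`-Lipschitz and `|ε| K ≤ 1/2`. [folklore] -/
def perturbHomeomorph {V : ℂ → ℂ} {K : ℝ≥0} (hV : LipschitzWith K V) {ε : ℝ} (hε : |ε| * K ≤ 1 / 2) :
    ℂ ≃ₜ ℂ where
  toFun z := z + (ε:ℂ) * V z
  invFun := (perturb_inverse hV hε).choose
  left_inv := (perturb_inverse hV hε).choose_spec.2.1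
  right_inv := (perturb_inverse hV hε).choose_spec.2.2
  continuous_toFun := continuous_id.add (continuous_const.mul hV.continuous)
  continuous_invFun := (perturb_inverse hV hε).choose_spec.1.continuous

/-- Every admissible field generates a family of plane homeomorphisms equal to `id + εV` near `ε = 0`. [folklore] -/
theorem exists_family {V : ℂ → ℂ} (hV : V ∈ niceSub) :
    ∃ Φ : ℝ → ℂ ≃ₜ ℂ, ∀ᶠ ε in 𝓝 (0:ℝ), ∀ z : ℂ, Φ ε z = z + (ε:ℂ) * V z := by
  classical
  obtain ⟨K, hK⟩ := lipschitz_of_mem hV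
  refine ⟨fun ε => if h : |ε| * K ≤ 1 / 2 then perturbHomeomorph hK h else Homeomorph.refl ℂ, ?_⟩
  have hc : Continuous (fun ε : ℝ => |ε| * (K:ℝ)) := by fun_prop
  have ht : Tendsto (fun ε : ℝ => |ε| * (K:ℝ)) (𝓝 0) (𝓝 0) := by simpa using hc.tendsto 0
  have hev : ∀ᶠ ε in 𝓝 (0:ℝ), |ε| * (K:ℝ) ≤ 1 / 2 :=
    (ht.eventually (eventually_lt_nhds (by norm_num : (0:ℝ) < 1 / 2))).mono fun ε h => h.le
  filter_upwards [hev] with ε hε z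
  simp only [dif_pos hε]
  rfl

theorem mem_famSet_of_forall {R : ConformalRectangle} {V : ℂ → ℂ} {Φ : ℝ → ℂ ≃ₜ ℂ}
    (h : ∀ᶠ ε in 𝓝 (0:ℝ), ∀ z : ℂ, Φ ε z = z + (ε:ℂ) * V z) : Φ ∈ famSet R V :=
  h.mono fun _ hε z _ => hε z


/-! ### Composition -/

/-- Composition lemma (sorry-free): cut-offs at the marks + triangle inequality + `C¹` bookkeeping. -/
theorem deformationLipschitz_of_pieces :
    (open Literature.Probability.Percolation Literature.Probability.LatticeModels Literature.Probability.RandomPlanarGeometry in ∀ R : ConformalRectangle, ∃ C₁ r₁ : ℝ, closure R.carrier ⊆ Metric.ball (0:ℂ) r₁ ∧ ∀ (V W : ℂ → ℂ), ContDiff ℝ 2 V → (∃ B : ℝ, ∀ z : ℂ, ‖V z‖ ≤ B * (1 + ‖z‖) ∧ ‖fderiv ℝ V z‖ ≤ B) → ContDiff ℝ 2 W → (∃ B : ℝ, ∀ z : ℂ, ‖W z‖ ≤ B * (1 + ‖z‖) ∧ ‖fderiv ℝ W z‖ ≤ B) → (∀ i : Fin 4, V (R.pt i) = W (R.pt i))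 → ∀ m : ℝ, (∀ z ∈ Metric.closedBall (0:ℂ) r₁, ‖V z - W z‖ + ‖fderiv ℝ V z - fderiv ℝ W z‖ ≤ m) → ∀ Φ : ℝ → ℂ ≃ₜ ℂ, (∀ᶠ ε in 𝓝 (0:ℝ), ∀ z ∈ closure R.carrier, Φ ε z = z + (ε : ℂ) * V z) → ∀ Ψ : ℝ → ℂ ≃ₜ ℂ, (∀ᶠ ε in 𝓝 (0:ℝ), ∀ z ∈ closure R.carrier, Ψ ε z = z + (ε : ℂ) * W z) → ∀ᶠ ε in 𝓝 (0:ℝ), ∀ᶠ δ in 𝓝[>] (0:ℝ), |bondDomainCrossingProb (R.map (Φ ε)) δ - bondDomainCrossingProb (R.map (Ψ ε)) δ| ≤ C₁ * |ε| * m) →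
    (open Literature.Probability.Percolation Literature.Probability.LatticeModels Literature.Probability.RandomPlanarGeometry in ∀ R : ConformalRectangle, ∀ ρ' : ℝ, 0 < ρ' → ∃ C₂ r₂ : ℝ, closure R.carrier ⊆ Metric.ball (0:ℂ) r₂ ∧ ∀ (V W : ℂ → ℂ), ContDiff ℝ 2 V → (∃ B : ℝ, ∀ z : ℂ, ‖V z‖ ≤ B * (1 + ‖z‖) ∧ ‖fderiv ℝ V z‖ ≤ B) → ContDiff ℝ 2 W → (∃ B : ℝ, ∀ z : ℂ, ‖W z‖ ≤ B * (1 + ‖z‖) ∧ ‖fderiv ℝ W z‖ ≤ B) → (∀ i : Fin 4, ∃ c : ℂ, ∀ z ∈ Metric.ball (R.pt i) ρ', V z - W z = c) → ∀ m : ℝ, (∀ z ∈ Metric.closedBall (0:ℂ) r₂, ‖V z - W z‖ + ‖fderiv ℝ V z - fderiv ℝ W z‖ ≤ m) → ∀ Φ : ℝ → ℂ ≃ₜ ℂ, (∀ᶠ ε in 𝓝 (0:ℝ), ∀ z ∈ closure R.carrier, Φ ε z = z + (ε : ℂ) * V z) → ∀ Ψ : ℝ → ℂ ≃ₜ ℂ,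 (∀ᶠ ε in 𝓝 (0:ℝ), ∀ z ∈ closure R.carrier, Ψ ε z = z + (ε : ℂ) * W z) → ∀ᶠ ε in 𝓝 (0:ℝ), ∀ᶠ δ in 𝓝[>] (0:ℝ), |bondDomainCrossingProb (R.map (Φ ε)) δ - bondDomainCrossingProb (R.map (Ψ ε)) δ| ≤ C₂ * |ε| * m) →
    (open Literature.Probability.Percolation Literature.Probability.LatticeModels Literature.Probability.RandomPlanarGeometry in ∀ R : ConformalRectangle, ∃ C r : ℝ, closure R.carrier ⊆ Metric.ball (0:ℂ) r ∧ ∀ V : ℂ → ℂ, ContDiff ℝ 2 V → (∃ B : ℝ, ∀ z : ℂ, ‖V z‖ ≤ B * (1 + ‖z‖) ∧ ‖fderiv ℝ V z‖ ≤ B) → ∀ Φ : ℝ → ℂ ≃ₜ ℂ, (∀ᶠ ε in 𝓝 (0:ℝ), ∀ z ∈ closure R.carrier, Φ ε z = z + (ε : ℂ) * V z) → ∀ᶠ ε in 𝓝 (0:ℝ), ∀ᶠ δ in 𝓝[>] (0:ℝ), |bondDomainCrossingProb (R.map (Φ ε)) δ - bondDomainCrossingProb (R.map (Φ 0)) δ|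 ≤ C * |ε| * sSup ((fun z : ℂ => ‖V z‖ + ‖fderiv ℝ V z‖) '' Metric.closedBall (0:ℂ) r)) := by
  intro h1 h2 R
  classical
  -- minimal separation of the (pairwise distinct) marked points
  let prs : Finset (Fin 4 × Fin 4) := Finset.univ.filter fun p => p.1 ≠ p.2
  have hprs : prs.Nonempty := ⟨(0, 1), by simp [prs]⟩
  let s : ℝ := prs.inf' hprs fun p => dist (R.pt p.1) (R.pt p.2)
  have hs0 : 0 < s := by
    refine (Finset.lt_inf'_iff hprs).2 fun p hp => dist_pos.2 (R.pt_injective.ne ?_)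
    simpa [prs] using hp
  have hsle : ∀ i j : Fin 4, i ≠ j → s ≤ dist (R.pt i) (R.pt j) := fun i j hij =>
    Finset.inf'_le (s := prs) (fun p : Fin 4 × Fin 4 => dist (R.pt p.1) (R.pt p.2))
      (show (i, j) ∈ prs by simpa [prs] using hij)
  -- the two stubs at this rectangle (`ρ' = s / 4` for the translation stub)
  obtain ⟨C₁, r₁, hR₁, h1⟩ := h1 R
  obtain ⟨C₂, r₂, hR₂, h2⟩ := h2 R (s / 4) (by positivity)
  -- smooth cut-offs at the marks
  let β : (i : Fin 4) → ContDiffBump (R.pt i) := fun i => ⟨s / 4, s / 3, by positivity, by linarith⟩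
  have hβ1 : ∀ i, (β i : ℂ → ℝ) (R.pt i) = 1 := fun i =>
    (β i).one_of_mem_closedBall (mem_closedBall_self (by positivity))
  have hβ0 : ∀ i j, i ≠ j → ∀ z ∈ ball (R.pt i) (s / 4), (β j : ℂ → ℝ) z = 0 := by
    intro i j hij z hz
    refine (β j).zero_of_le_dist ?_
    show s / 3 ≤ dist z (R.pt j)
    have h := hsle i j hij
    rw [mem_ball] at hz
    have := dist_triangle (R.pt i) z (R.pt j)
    rw [dist_comm (R.pt i) z] at this
    linarith
  have hβ1' : ∀ i, ∀ z ∈ ball (R.pt i) (s / 4), (β i : ℂ → ℝ) z = 1 := fun i z hz =>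
    (β i).one_of_mem_closedBall (ball_subset_closedBall hz)
  -- derivative bounds of the cut-offs
  have hβd : ∀ i, ∃ D : ℝ, 0 ≤ D ∧ ∀ z, ‖fderiv ℝ (β i : ℂ → ℝ) z‖ ≤ D := by
    intro i
    have hc : Continuous (fderiv ℝ (β i : ℂ → ℝ)) := ((β i).contDiff (n := 1)).continuous_fderiv one_ne_zero
    obtain ⟨D, hD⟩ := hc.bounded_above_of_compact_support ((β i).hasCompactSupport.fderiv (𝕜 := ℝ))
    exact ⟨max D 0, le_max_right _ _, fun z => (hD z).trans (le_max_left _ _)⟩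
  choose D hD0 hD using hβd
  -- the constants
  refine ⟨C₁ * (5 + ∑ i, D i) + C₂ * (4 + ∑ i, D i), max r₁ r₂, hR₁.trans (ball_subset_ball (le_max_left _ _)),
    fun V hV1 hV2 Φ hΦ => ?_⟩
  set M : ℝ := sSup ((fun z : ℂ => ‖V z‖ + ‖fderiv ℝ V z‖) '' Metric.closedBall (0:ℂ) (max r₁ r₂)) with hM
  have hVd : Differentiable ℝ V := hV1.differentiable (by norm_num)
  have hgc : Continuous fun z : ℂ => ‖V z‖ + ‖fderiv ℝ V z‖ :=
    (hV1.continuous.norm).add (hV1.continuous_fderiv (by norm_num)).norm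
  have hbdd : BddAbove ((fun z : ℂ => ‖V z‖ + ‖fderiv ℝ V z‖) '' Metric.closedBall (0:ℂ) (max r₁ r₂)) :=
    (isCompact_closedBall _ _).bddAbove_image hgc.continuousOn
  have hgM : ∀ z ∈ closedBall (0:ℂ) (max r₁ r₂), ‖V z‖ + ‖fderiv ℝ V z‖ ≤ M := fun z hz =>
    le_csSup hbdd (mem_image_of_mem _ hz)
  -- the marks lie in the closed ball
  have hptM : ∀ i, ‖V (R.pt i)‖ ≤ M := fun i => by
    have hi : R.pt i ∈ closedBall (0:ℂ) (max r₁ r₂) :=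
      ball_subset_closedBall ((hR₁.trans (ball_subset_ball (le_max_left _ _)))
        (frontier_subset_closure (R.pt_mem_frontier i)))
    exact ((le_add_of_nonneg_right (norm_nonneg _)).trans (hgM _ hi))
  have hM0 : 0 ≤ M := (norm_nonneg _).trans (hptM 0)
  -- the intermediate field `W = Σ βᵢ • V(pt i)`
  let W : ℂ → ℂ := fun z => ∑ i, ((β i : ℂ → ℝ) z) • V (R.pt i)
  have hWdiff : ∀ i, Differentiable ℝ fun z => ((β i : ℂ → ℝ) z) • V (R.pt i) := fun i =>
    (((β i).contDiff (n := 1)).differentiable one_ne_zero).smul_const _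
  have hW1 : ContDiff ℝ 2 W := ContDiff.sum fun i _ => (β i).contDiff.smul contDiff_const
  have hWn : ∀ z, ‖W z‖ ≤ 4 * M := fun z => by
    calc ‖W z‖ ≤ ∑ i, ‖((β i : ℂ → ℝ) z) • V (R.pt i)‖ := norm_sum_le _ _
      _ ≤ ∑ _i : Fin 4, M := Finset.sum_le_sum fun i _ => by
          rw [norm_smul, Real.norm_eq_abs, abs_of_nonneg (β i).nonneg]
          exact (mul_le_of_le_one_left (norm_nonneg _) (β i).le_one).trans (hptM i)
      _ = 4 * M := by simp
  have hWd : ∀ z, ‖fderiv ℝ W z‖ ≤ (∑ i, D i) * M := fun z => by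
    have : fderiv ℝ W z = ∑ i, fderiv ℝ (fun w => ((β i : ℂ → ℝ) w) • V (R.pt i)) z := by
      have hWeq : W = ∑ i, fun w => ((β i : ℂ → ℝ) w) • V (R.pt i) := by
        funext w; simp only [W, Finset.sum_apply]
      rw [hWeq]
      exact fderiv_sum fun i _ => hWdiff i z
    rw [this, Finset.sum_mul]
    refine (norm_sum_le _ _).trans (Finset.sum_le_sum fun i _ => ?_)
    rw [fderiv_smul_const ((((β i).contDiff (n := 1)).differentiable one_ne_zero) z),
      ContinuousLinearMap.norm_smulRight_apply]
    exact mul_le_mul (hD i z) (hptM i) (norm_nonneg _) (hD0 i)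
  have hDnn : 0 ≤ ∑ i, D i := Finset.sum_nonneg fun i _ => hD0 i
  have hW2 : ∃ B : ℝ, ∀ z : ℂ, ‖W z‖ ≤ B * (1 + ‖z‖) ∧ ‖fderiv ℝ W z‖ ≤ B := by
    refine ⟨(4 + ∑ i, D i) * M, fun z => ⟨?_, ?_⟩⟩
    · calc ‖W z‖ ≤ 4 * M := hWn z
        _ ≤ (4 + ∑ i, D i) * M := by nlinarith
        _ ≤ (4 + ∑ i, D i) * M * (1 + ‖z‖) :=
          le_mul_of_one_le_right (by positivity) (by linarith [norm_nonneg z])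
    · calc ‖fderiv ℝ W z‖ ≤ (∑ i, D i) * M := hWd z
        _ ≤ (4 + ∑ i, D i) * M := by nlinarith
  have hW : W ∈ niceSub := ⟨hW1, hW2⟩
  -- `V - W` vanishes at the marks; `W` is constant near each mark
  have hVW : ∀ i : Fin 4, V (R.pt i) = W (R.pt i) := fun i => by
    show V (R.pt i) = ∑ j, ((β j : ℂ → ℝ) (R.pt i)) • V (R.pt j)
    rw [Finset.sum_eq_single i (fun j _ hji => by
      rw [hβ0 i j (Ne.symm hji) _ (mem_ball_self (by positivity)), zero_smul]) (fun h => (h (Finset.mem_univ _)).elim)]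
    rw [hβ1 i, one_smul]
  have hWc : ∀ i : Fin 4, ∃ c : ℂ, ∀ z ∈ Metric.ball (R.pt i) (s / 4), W z - (0 : ℂ → ℂ) z = c := fun i => by
    refine ⟨V (R.pt i), fun z hz => ?_⟩
    show (∑ j, ((β j : ℂ → ℝ) z) • V (R.pt j)) - 0 = V (R.pt i)
    rw [sub_zero, Finset.sum_eq_single i (fun j _ hji => by rw [hβ0 i j (Ne.symm hji) z hz, zero_smul])
      (fun h => (h (Finset.mem_univ _)).elim), hβ1' i z hz, one_smul]
  -- pointwise `C¹` sizes of the two differences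
  have hm1 : ∀ z ∈ Metric.closedBall (0:ℂ) r₁, ‖V z - W z‖ + ‖fderiv ℝ V z - fderiv ℝ W z‖ ≤ (5 + ∑ i, D i) * M := by
    intro z hz
    have hz' : z ∈ closedBall (0:ℂ) (max r₁ r₂) := closedBall_subset_closedBall (le_max_left _ _) hz
    calc ‖V z - W z‖ + ‖fderiv ℝ V z - fderiv ℝ W z‖
        ≤ (‖V z‖ + ‖W z‖) + (‖fderiv ℝ V z‖ + ‖fderiv ℝ W z‖) := add_le_add (norm_sub_le _ _) (norm_sub_le _ _)
      _ = (‖V z‖ + ‖fderiv ℝ V z‖) + (‖W z‖ + ‖fderiv ℝ W z‖) := by ring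
      _ ≤ M + (4 * M + (∑ i, D i) * M) := add_le_add (hgM z hz') (add_le_add (hWn z) (hWd z))
      _ = (5 + ∑ i, D i) * M := by ring
  have hm2 : ∀ z ∈ Metric.closedBall (0:ℂ) r₂, ‖W z - (0 : ℂ → ℂ) z‖ + ‖fderiv ℝ W z - fderiv ℝ (0 : ℂ → ℂ) z‖ ≤
      (4 + ∑ i, D i) * M := by
    intro z _
    have h0 : fderiv ℝ (0 : ℂ → ℂ) z = 0 := by
      change fderiv ℝ (fun _ : ℂ => (0:ℂ)) z = 0
      exact fderiv_const_apply 0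
    rw [h0, sub_zero, Pi.zero_apply, sub_zero]
    calc ‖W z‖ + ‖fderiv ℝ W z‖ ≤ 4 * M + (∑ i, D i) * M := add_le_add (hWn z) (hWd z)
      _ = (4 + ∑ i, D i) * M := by ring
  -- the families: a global `W`-family, and the constant family `Φ 0` for the zero field
  obtain ⟨Ψ, hΨ⟩ := exists_family hW
  have hΨ' : ∀ᶠ ε in 𝓝 (0:ℝ), ∀ z ∈ closure R.carrier, Ψ ε z = z + (ε : ℂ) * W z := hΨ.mono fun _ h z _ => h z
  have hΘ : ∀ᶠ ε in 𝓝 (0:ℝ), ∀ z ∈ closure R.carrier, (fun _ : ℝ => Φ 0) ε z = z + (ε : ℂ) * (0 : ℂ → ℂ) z := by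
    refine Filter.Eventually.of_forall fun ε z hz => ?_
    have := hΦ.self_of_nhds z hz
    simp only [Pi.zero_apply, mul_zero, add_zero]
    simpa using this
  have hz : (0 : ℂ → ℂ) ∈ niceSub := niceSub.zero_mem
  have e1 := h1 V W hV1 hV2 hW1 hW2 hVW _ hm1 Φ hΦ Ψ hΨ'
  have e2 := h2 W 0 hW1 hW2 hz.1 hz.2 hWc _ hm2 Ψ hΨ' (fun _ => Φ 0) hΘ
  filter_upwards [e1, e2] with ε f1 f2
  filter_upwards [f1, f2] with δ g1 g2
  calc |bondDomainCrossingProb (R.map (Φ ε)) δ - bondDomainCrossingProb (R.map (Φ 0)) δ|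
      = |(bondDomainCrossingProb (R.map (Φ ε)) δ - bondDomainCrossingProb (R.map (Ψ ε)) δ) +
          (bondDomainCrossingProb (R.map (Ψ ε)) δ - bondDomainCrossingProb (R.map (Φ 0)) δ)| := by ring_nf
    _ ≤ |bondDomainCrossingProb (R.map (Φ ε)) δ - bondDomainCrossingProb (R.map (Ψ ε)) δ| +
          |bondDomainCrossingProb (R.map (Ψ ε)) δ - bondDomainCrossingProb (R.map (Φ 0)) δ| := abs_add_le _ _
    _ ≤ C₁ * |ε| * ((5 + ∑ i, D i) * M) + C₂ * |ε| * ((4 + ∑ i, D i) * M) := add_le_add g1 g2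
    _ = (C₁ * (5 + ∑ i, D i) + C₂ * (4 + ∑ i, D i)) * |ε| * M := by ring

/-- **Registered composition BY NAME** (`ledger skeleton check --crux <child item>`): the ROUTE DECL
`CardyStressTensorWard.DeformationLipschitz` (rev-5 route file) from the two sorried stubs `stub_lipVanishingAtMarks`,
`stub_lipMarkTranslation` through the sorry-free composition lemma `deformationLipschitz_of_pieces` (the decl's body is
definitionally that lemma's conclusion). No sorry here; the only sorries of the file are the two stubs. -/
theorem DeformationLipschitz_of :
    Summit.CriticalPhenomena.CardyFormulaZ2.Theses.CardyStressTensorWard.DeformationLipschitz :=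
  deformationLipschitz_of_pieces stub_lipVanishingAtMarks stub_lipMarkTranslation

end Summit.CriticalPhenomena.CardyFormulaZ2.Cruxes.HadamardRegularity.BirthDeformationLipschitz

end
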